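import Summits.AnomalousDissipation.AnomalousDissipation.Theorems.SolenoidalFractalHomogenisationLagrangianCarrierAnalyticFlow
import Literature.Analysis.FunctionSpaces.TorusAnalyticCompositionProof
import HarnessLib

/-!
# Analytic tower of a Lagrangian lattice carrier, V: ALL label-gradients of the window displacement are `O(strain)`
# (helper for K1L_D `stmt-AnomalousDissipation-27980`, (ℓ3-A) road A `…FrameInstanceRegularity` (F6); `--supports`)

Summits-side helper file (everything proved; no definitions, no named facts).  §1–§4 are stated for the abstract forward window
flow `X = id + proj∘D` of a field `f` on `T^d` exactly as in `Literature.Analysis.ODE.TorusFlowGradientEstimateWithin`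
(Armstrong–Vicol App. A Prop. 7.11 on `[0,T₀]`, chain rule within the window): IF `⟦f(t)⟧_{n,R_f} ≤ C_f` (`1 ≤ n ≤ N`) and
`T₀ ≤ 1/(4dC_fR_f)`, THEN every label derivative of ORDER AT LEAST TWO of the displacement is small, LINEARLY in `C_f R_f t`:
`|∂^l D_i(t,x)| ≤ 48 d² · (C_f R_f t) · n! R_*ⁿ/(n+1)²` for `|l| = n+1`, `1 ≤ n`, `n+1 ≤ N`, `R_* = 24dR_f(1+d²)` (§4,
`abs_iterPartialDeriv_disp_le_forward_ofDerivWithin`).  Road (no Grönwall beyond Prop. 7.11): `∂ₜ∂^l D = ∂^l(f∘X)` within the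
window; `∂^{l'++[c]}(f_i∘X) = ∂^{l'} Σ_q (∂_q f_i ∘ X)·(∇X)_{qc}`; the composition estimate (AV Prop. 7.6, PROVED in the tree:
`ArmstrongVicol2025_composition_holds`) for `h = ∂_q f_i` — whose amplitude `C_f R_f` is the smallness — with `⟦∇X⟧ ≤ 6d` (Prop. 7.11, tree);
the product estimate (Lemma 7.1, `dnorm_mul_le`); the mean-value inequality from `∂^l D(0) = 0`.
The companion file `…LagrangianCarrierAnalyticDispStrain` feeds it with the analytic tower (`analytic_tower`): on every refresh window of
level `m+1` the coarse displacement `disp m (jR+u) (jR)` has `|∂^l disp_a| ≤ C_D · n! · strain m · (ϱ_D N_m)ⁿ` for `|l| = n+1 ≥ 2`, constants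
depending on the design only.  Infrastructure for route-1's rung leaf F-D1.A0 (a frontier FORMAL rung); NOT a proof of K1L_D or of anomalous dissipation.
-/

set_option linter.dupNamespace false

noncomputable section

namespace Summit.AnomalousDissipation.AnomalousDissipation.Theorems.SolenoidalFractalHomogenisation.LagrangianCarrierAnalytic

/-! ## §1–§4 The abstract forward window flow -/

section General

open Set Function Filter MeasureTheory Finset
open scoped Topology Nat ContDiff
open Literature.Analysis Literature.Analysis.ODE Literature.Analysis.ODE.TorusFlow
open Literature.Analysis.FunctionSpaces Literature.Analysis.FunctionSpaces.Torus

variable {d : Type*} [Fintype d] [DecidableEq d]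

variable {f D : ℝ → UnitAddTorus d → EuclideanSpace ℝ d} {Cf Rf : ℝ} {N : ℕ}

/-- `(k+1)·2^{-k} ≤ 1`. [folklore] -/
theorem succ_mul_half_pow_le_one (k : ℕ) : ((k : ℝ) + 1) * (1 / 2) ^ k ≤ 1 := by
  have h : (k : ℝ) + 1 ≤ 2 ^ k := by
    have := Nat.lt_two_pow_self (n := k)
    exact_mod_cast this
  rw [one_div_pow, mul_one_div, div_le_one (by positivity)]
  exact h

/-- `(k+1)³/(k+2)² ≤ k+1`. [folklore] -/
theorem cube_div_sq_le (k : ℕ) : ((k : ℝ) + 1) ^ 3 / ((k : ℝ) + 2) ^ 2 ≤ (k : ℝ) + 1 := by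
  rw [div_le_iff₀ (by positivity)]
  have hk : (0 : ℝ) ≤ k := Nat.cast_nonneg k
  nlinarith [sq_nonneg ((k : ℝ) + 1)]

/-- `(k+1)²/k³ ≤ 9/8` for `k ≥ 2`. [folklore] -/
theorem sq_div_cube_le (k : ℕ) (hk : 2 ≤ k) : ((k : ℝ) + 1) ^ 2 / (k : ℝ) ^ 3 ≤ 9 / 8 := by
  have hk' : (2 : ℝ) ≤ k := by exact_mod_cast hk
  rw [div_le_iff₀ (by positivity)]
  nlinarith [sq_nonneg ((k : ℝ) - 2), mul_nonneg (by linarith : (0:ℝ) ≤ (k:ℝ) - 2) (sq_nonneg (k : ℝ))]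

/-- **§1 The Jacobian factor at every order `≤ n` and every radius parameter `R ≥ 24dR_f`**: `⟦δ_{qc} + ∂_c D_q(t)⟧_{j,R} ≤ 6d`
for `0 ≤ j ≤ n`, `n + 1 ≤ N`, `t ∈ [0,T₀]` (order `0`: `|δ + ∂D| ≤ 3`; orders `≥ 1`: Prop. 7.11 and anti-monotonicity in the radius).
[cite: ArmstrongVicol2025, App. A Prop. 7.11 ((e.ODE.flow.estimate)); Prop. 7.10 (first display)] -/
theorem dnorm_flowJac_entry_le_all (hCf : 0 < Cf) (hRf : 0 < Rf)
    (hfs : ∀ t, IsSmooth (f t)) (hDs : ∀ t, IsSmooth (D t)) (hD0 : ∀ x, D 0 x = 0)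
    {T₀ : ℝ} (hT₀ : T₀ ≤ 1 / (4 * (Fintype.card d : ℝ) * Cf * Rf))
    (hDt : ∀ (l : List d) (i : d) (x : UnitAddTorus d), ∀ t ∈ Icc 0 T₀,
      HasDerivWithinAt (fun s => iterPartialDeriv l (fun y => D s y i) x)
        (iterPartialDeriv l (fun y => f t (y + proj (D t y)) i) x) (Icc 0 T₀) t)
    (hfb : ∀ n, 1 ≤ n → n ≤ N → ∀ t, dnorm n Rf (f t) ≤ Cf)
    {n : ℕ} (hnN : n + 1 ≤ N) {t : ℝ} (ht : t ∈ Icc 0 T₀) {R : ℝ} (hR : 24 * (Fintype.card d : ℝ) * Rf ≤ R)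
    (q c : d) : ∀ j ≤ n, dnorm j R (fun y => (1 : Matrix d d ℝ) q c + partialDeriv c (fun x => D t x q) y) ≤
      6 * (Fintype.card d : ℝ) := by
  intro j hj
  set dd : ℝ := (Fintype.card d : ℝ) with hdd
  have hdd1 : 1 ≤ dd := by
    have : Nonempty d := ⟨q⟩
    have hcard : 1 ≤ Fintype.card d := Nat.succ_le_of_lt Fintype.card_pos
    rw [hdd]; exact_mod_cast hcard
  have hBt : 8 * dd * Cf * Rf * t ≤ 2 := by
    have h1 : 8 * dd * Cf * Rf * t ≤ 8 * dd * Cf * Rf * (1 / (4 * dd * Cf * Rf)) :=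
      mul_le_mul_of_nonneg_left (ht.2.trans hT₀) (by positivity)
    have h2 : 8 * dd * Cf * Rf * (1 / (4 * dd * Cf * Rf)) = 2 := by field_simp; ring
    linarith
  have hρ0 : 0 < 8 * dd * Rf * (1 + 8 * dd * Cf * Rf * t) := by
    have : 0 ≤ t := ht.1
    positivity
  have hρle : 8 * dd * Rf * (1 + 8 * dd * Cf * Rf * t) ≤ R := by
    have : 8 * dd * Rf * (1 + 8 * dd * Cf * Rf * t) ≤ 24 * dd * Rf := by
      nlinarith [hBt, mul_pos (mul_pos (by norm_num : (0:ℝ) < 8) (by linarith : (0:ℝ) < dd)) hRf]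
    exact this.trans hR
  rcases Nat.eq_zero_or_pos j with rfl | hj1
  · -- order zero: `|δ_{qc} + ∂_c D_q| ≤ 1 + 2 ≤ 6d`
    rw [dnorm_def]
    simp only [Nat.cast_zero, zero_add, one_pow, Nat.factorial_zero, Nat.cast_one, pow_zero, mul_one, div_one, one_mul]
    refine derivSup_le (by positivity) fun l hl y => ?_
    obtain rfl : l = [] := List.eq_nil_of_length_eq_zero hl
    rw [iterPartialDeriv_nil, Real.norm_eq_abs]
    have h1 : |(1 : Matrix d d ℝ) q c| ≤ 1 := by rw [Matrix.one_apply]; split_ifs <;> simp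
    have h2 := abs_partialDeriv_disp_le_forward_ofDerivWithin hCf hRf (by omega) hfs hDs hD0 hT₀ hDt hfb ht c q y
    calc |(1 : Matrix d d ℝ) q c + partialDeriv c (fun x => D t x q) y|
        ≤ |(1 : Matrix d d ℝ) q c| + |partialDeriv c (fun x => D t x q) y| := abs_add_le _ _
      _ ≤ 1 + 2 := add_le_add h1 (h2.trans (by rw [← hdd]; exact hBt))
      _ ≤ 6 * dd := by linarith
  · have h711 := dnorm_flowGrad_le_forward_ofDerivWithin hCf hRf hfs hDs hD0 hT₀ hDt hfb j hj1 (by omega) t ht q c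
    rw [← hdd] at h711
    exact (dnorm_anti_radius j hρ0 hρle _).trans h711

/-- **§2 The composed field gradient** `y ↦ (∂_q f_i)(t, X(t,y))` at every order `≤ n`: `⟦∂_q f_i(t) ∘ X(t)⟧_{j,R_*} ≤ C_f R_f`,
`R_* = 24dR_f(1+d²)`, for `1 ≤ n`, `n + 1 ≤ N`, `t ∈ [0,T₀]` — the composition estimate (Prop. 7.6) with `h = ∂_q f_i(t)`
(`⟦h⟧_{k,2R_f} ≤ C_fR_f` from the derivative shift), `g = X(t)` (`R_g = 24dR_f`, `C_g = d/(2R_f)` from Prop. 7.11).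
[cite: ArmstrongVicol2025, App. A Prop. 7.6 (composition estimate), Prop. 7.11] -/
theorem dnorm_partialDeriv_comp_flow_le (hCf : 0 < Cf) (hRf : 0 < Rf)
    (hfs : ∀ t, IsSmooth (f t)) (hDs : ∀ t, IsSmooth (D t)) (hD0 : ∀ x, D 0 x = 0)
    {T₀ : ℝ} (hT₀ : T₀ ≤ 1 / (4 * (Fintype.card d : ℝ) * Cf * Rf))
    (hDt : ∀ (l : List d) (i : d) (x : UnitAddTorus d), ∀ t ∈ Icc 0 T₀,
      HasDerivWithinAt (fun s => iterPartialDeriv l (fun y => D s y i) x)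
        (iterPartialDeriv l (fun y => f t (y + proj (D t y)) i) x) (Icc 0 T₀) t)
    (hfb : ∀ n, 1 ≤ n → n ≤ N → ∀ t, dnorm n Rf (f t) ≤ Cf)
    {n : ℕ} (hn1 : 1 ≤ n) (hnN : n + 1 ≤ N) {t : ℝ} (ht : t ∈ Icc 0 T₀) (q i : d) :
    ∀ j ≤ n, dnorm j (24 * (Fintype.card d : ℝ) * Rf * (1 + (Fintype.card d : ℝ) ^ 2))
      (fun y => partialDeriv q (fun z => f t z i) (y + proj (D t y))) ≤ Cf * Rf := by
  classical
  set dd : ℝ := (Fintype.card d : ℝ) with hdd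
  have hdd1 : 1 ≤ dd := by
    have : Nonempty d := ⟨q⟩
    have hcard : 1 ≤ Fintype.card d := Nat.succ_le_of_lt Fintype.card_pos
    rw [hdd]; exact_mod_cast hcard
  have hBt : 8 * dd * Cf * Rf * t ≤ 2 := by
    have h1 : 8 * dd * Cf * Rf * t ≤ 8 * dd * Cf * Rf * (1 / (4 * dd * Cf * Rf)) :=
      mul_le_mul_of_nonneg_left (ht.2.trans hT₀) (by positivity)
    have h2 : 8 * dd * Cf * Rf * (1 / (4 * dd * Cf * Rf)) = 2 := by field_simp; ring
    linarith
  -- data of the composition estimate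
  set Rg : ℝ := 24 * dd * Rf with hRg
  set Cg : ℝ := dd / (2 * Rf) with hCg
  set Rh : ℝ := 2 * Rf with hRh
  have hRg0 : 0 < Rg := by positivity
  have hCg0 : 0 < Cg := by positivity
  have hRh0 : 0 < Rh := by positivity
  have hCh0 : 0 < Cf * Rf := mul_pos hCf hRf
  have hfi : IsSmooth (fun z => f t z i) := (hfs t).apply i
  have hh : IsSmooth (partialDeriv q (fun z => f t z i)) := hfi.partialDeriv q
  -- (a) `⟦∂_q f_i⟧_{k,2R_f} ≤ C_f R_f` for `k ≤ n`
  have ha : ∀ k, k ≤ n → dnorm k Rh (partialDeriv q (fun z => f t z i)) ≤ Cf * Rf := by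
    intro k hk
    rw [hRh, dnorm_radius_scale k hRf hRh0, show Rf / (2 * Rf) = 1 / 2 by field_simp]
    have h1 := dnorm_partialDeriv_le k hRf hfi q
    have h2 : dnorm (k + 1) Rf (fun z => f t z i) ≤ Cf :=
      (dnorm_apply_le (k + 1) hRf.le (hfs t) i).trans (hfb (k + 1) (by omega) (by omega) t)
    have h3 : ((k : ℝ) + 1) ^ 3 * Rf / ((k : ℝ) + 2) ^ 2 ≤ ((k : ℝ) + 1) * Rf := by
      have := cube_div_sq_le k
      rw [mul_div_right_comm]
      exact mul_le_mul_of_nonneg_right this hRf.le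
    have hw0 : 0 ≤ ((k : ℝ) + 1) ^ 3 * Rf / ((k : ℝ) + 2) ^ 2 := by positivity
    calc (1 / 2 : ℝ) ^ k * dnorm k Rf (partialDeriv q (fun z => f t z i))
        ≤ (1 / 2 : ℝ) ^ k * ((((k : ℝ) + 1) ^ 3 * Rf / ((k : ℝ) + 2) ^ 2) * dnorm (k + 1) Rf (fun z => f t z i)) :=
          mul_le_mul_of_nonneg_left h1 (by positivity)
      _ ≤ (1 / 2 : ℝ) ^ k * ((((k : ℝ) + 1) * Rf) * Cf) := by
          refine mul_le_mul_of_nonneg_left ?_ (by positivity)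
          exact mul_le_mul h3 h2 (dnorm_nonneg _ hRf.le _) (by positivity)
      _ = (((k : ℝ) + 1) * (1 / 2) ^ k) * (Cf * Rf) := by ring
      _ ≤ 1 * (Cf * Rf) := mul_le_mul_of_nonneg_right (succ_mul_half_pow_le_one k) hCh0.le
      _ = Cf * Rf := one_mul _
  -- (b) `4/R_g · ‖e_j + ∂_j D‖ ≤ C_g`
  have hb : 1 ≤ n → ∀ (j : d) (y : UnitAddTorus d), 4 / Rg * ‖EuclideanSpace.single j (1 : ℝ) + partialDeriv j (D t) y‖ ≤ Cg := by
    intro _ j y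
    have hD1 : ∀ i', |partialDeriv j (fun x => D t x i') y| ≤ 2 := fun i' =>
      (abs_partialDeriv_disp_le_forward_ofDerivWithin hCf hRf (by omega) hfs hDs hD0 hT₀ hDt hfb ht j i' y).trans
        (by rw [← hdd]; exact hBt)
    have hnD : ‖partialDeriv j (D t) y‖ ≤ 2 * dd := by
      rw [EuclideanSpace.norm_eq]
      have hsum : ∑ i', ‖(partialDeriv j (D t) y) i'‖ ^ 2 ≤ (2 * dd) ^ 2 := by
        have hle : ∀ i', ‖(partialDeriv j (D t) y) i'‖ ^ 2 ≤ 2 ^ 2 := by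
          intro i'
          rw [← partialDeriv_apply_coord ((hDs t).isContDiff (by simp)) j y i', Real.norm_eq_abs]
          exact pow_le_pow_left₀ (abs_nonneg _) (hD1 i') 2
        calc ∑ i', ‖(partialDeriv j (D t) y) i'‖ ^ 2 ≤ ∑ _i' : d, (2 : ℝ) ^ 2 := Finset.sum_le_sum fun i' _ => hle i'
          _ = dd * 2 ^ 2 := by rw [Finset.sum_const, Finset.card_univ, nsmul_eq_mul, hdd]
          _ ≤ (2 * dd) ^ 2 := by nlinarith
      calc Real.sqrt (∑ i', ‖(partialDeriv j (D t) y) i'‖ ^ 2) ≤ Real.sqrt ((2 * dd) ^ 2) := Real.sqrt_le_sqrt hsum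
        _ = 2 * dd := Real.sqrt_sq (by positivity)
    have hn1' : ‖EuclideanSpace.single j (1 : ℝ) + partialDeriv j (D t) y‖ ≤ 3 * dd := by
      refine (norm_add_le _ _).trans ?_
      have hs1 : ‖EuclideanSpace.single j (1 : ℝ)‖ = 1 := by simp
      rw [hs1]
      linarith
    calc 4 / Rg * ‖EuclideanSpace.single j (1 : ℝ) + partialDeriv j (D t) y‖ ≤ 4 / Rg * (3 * dd) :=
          mul_le_mul_of_nonneg_left hn1' (by positivity)
      _ = 1 / (2 * Rf) := by rw [hRg]; field_simp; ring
      _ ≤ Cg := by rw [hCg]; exact div_le_div_of_nonneg_right (by linarith) (by positivity)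
  -- (c) `⟦D(t)⟧_{k,R_g} ≤ C_g` for `2 ≤ k ≤ n`
  have hc : ∀ k, 2 ≤ k → k ≤ n → dnorm k Rg (D t) ≤ Cg := by
    intro k hk2 hkn
    refine (dnorm_le_sum_dnorm_apply k hRg0.le (hDs t)).trans ?_
    have hcoord : ∀ i', dnorm k Rg (fun y => D t y i') ≤ 9 / (32 * Rf) := by
      intro i'
      obtain ⟨k', rfl⟩ : ∃ k', k = k' + 1 := ⟨k - 1, by omega⟩
      have hk'1 : 1 ≤ k' := by omega
      -- `derivSup (k'+1) D_i' ≤ 6d k'! R_g^{k'}/(k'+1)²`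
      have hJ := dnorm_flowJac_entry_le_all hCf hRf hfs hDs hD0 hT₀ hDt hfb (n := n) hnN ht (R := Rg) (by rw [hRg]) i'
      have hDsup : derivSup (k' + 1) (fun y => D t y i') ≤ 6 * dd * ((Nat.factorial k' : ℝ) * Rg ^ k') / ((k' : ℝ) + 1) ^ 2 := by
        refine derivSup_le (by positivity) fun l hl y => ?_
        obtain ⟨l', j, rfl, hl'⟩ := List.exists_eq_concat_of_length_eq_succ hl
        have hl'ne : l' ≠ [] := by intro h; subst h; simp at hl'; omega
        have hDi : IsSmooth (fun y => D t y i') := (hDs t).apply i'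
        have e1 : iterPartialDeriv (l' ++ [j]) (fun y => D t y i') y =
            iterPartialDeriv l' (fun y => (1 : Matrix d d ℝ) i' j + partialDeriv j (fun x => D t x i') y) y := by
          rw [iterPartialDeriv_concat, iterPartialDeriv_add (isSmooth_const ((1 : Matrix d d ℝ) i' j)) (hDi.partialDeriv j) l']
          simp only
          rw [iterPartialDeriv_const ((1 : Matrix d d ℝ) i' j) l' hl'ne, Pi.zero_apply, zero_add]
        rw [e1]
        exact norm_iterPartialDeriv_le_of_dnorm_le ((isSmooth_const _).add (hDi.partialDeriv j)) hRg0
          (hJ j k' (by omega)) hl' y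
      rw [dnorm_def]
      have hfac : (Nat.factorial (k' + 1) : ℝ) = ((k' : ℝ) + 1) * (Nat.factorial k' : ℝ) := by
        rw [Nat.factorial_succ]; push_cast; ring
      calc (((k' + 1 : ℕ) : ℝ) + 1) ^ 2 / ((Nat.factorial (k' + 1) : ℝ) * Rg ^ (k' + 1)) * derivSup (k' + 1) (fun y => D t y i')
          ≤ (((k' + 1 : ℕ) : ℝ) + 1) ^ 2 / ((Nat.factorial (k' + 1) : ℝ) * Rg ^ (k' + 1)) *
              (6 * dd * ((Nat.factorial k' : ℝ) * Rg ^ k') / ((k' : ℝ) + 1) ^ 2) :=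
            mul_le_mul_of_nonneg_left hDsup (dnorm_weight_pos (k' + 1) hRg0).le
        _ = 6 * dd * ((((k' + 1 : ℕ) : ℝ) + 1) ^ 2 / (((k' + 1 : ℕ) : ℝ)) ^ 3) / Rg := by
            rw [hfac, pow_succ]
            have h1 : (Nat.factorial k' : ℝ) ≠ 0 := by exact_mod_cast (Nat.factorial_pos k').ne'
            have h2 : Rg ^ k' ≠ 0 := pow_ne_zero _ hRg0.ne'
            have h3 : (k' : ℝ) + 1 ≠ 0 := by positivity
            push_cast
            field_simp
            ring
        _ ≤ 6 * dd * (9 / 8) / Rg := by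
            refine div_le_div_of_nonneg_right (mul_le_mul_of_nonneg_left (sq_div_cube_le (k' + 1) (by omega)) (by positivity)) hRg0.le
        _ = 9 / (32 * Rf) := by rw [hRg]; field_simp; ring
    calc ∑ i', dnorm k Rg (fun y => D t y i') ≤ ∑ _i' : d, 9 / (32 * Rf) := Finset.sum_le_sum fun i' _ => hcoord i'
      _ = dd * (9 / (32 * Rf)) := by rw [Finset.sum_const, Finset.card_univ, nsmul_eq_mul, hdd]
      _ ≤ Cg := by rw [hCg, div_eq_mul_one_div dd]; exact mul_le_mul_of_nonneg_left (by
            rw [div_le_div_iff₀ (by positivity) (by positivity)]; nlinarith) (by positivity)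
  -- the composition estimate
  have key := ArmstrongVicol2025_composition_holds d n (partialDeriv q (fun z => f t z i)) (D t) (Cf * Rf) Cg Rh Rg
    hCh0 hCg0 hRh0 hRg0 hh (hDs t) ha hb hc
  have eR : Rg * (1 + (Fintype.card d : ℝ) * Cg * Rh) = 24 * dd * Rf * (1 + dd ^ 2) := by
    rw [hRg, hCg, hRh, ← hdd]; field_simp
  intro j hj
  have h := key j hj
  rw [eR] at h
  exact h


/-- **§3 The time derivative of a label derivative of order `≥ 2`, bounded**: for `|l'| = n ≥ 1`, `n + 1 ≤ N`, `t ∈ [0,T₀]`,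
`|∂^{l'++[c]} (f_i(t) ∘ X(t))(x)| ≤ 48 d² C_f R_f · n! R_*ⁿ/(n+1)²` (chain rule `∂_c(f_i∘X) = Σ_q (∂_q f_i∘X)(∇X)_{qc}`, product
estimate Lemma 7.1 with §1 and §2, read-out). [cite: ArmstrongVicol2025, App. A Lemma 7.1, Prop. 7.6, Prop. 7.11] -/
theorem abs_iterPartialDeriv_comp_flow_le (hCf : 0 < Cf) (hRf : 0 < Rf)
    (hfs : ∀ t, IsSmooth (f t)) (hDs : ∀ t, IsSmooth (D t)) (hD0 : ∀ x, D 0 x = 0)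
    {T₀ : ℝ} (hT₀ : T₀ ≤ 1 / (4 * (Fintype.card d : ℝ) * Cf * Rf))
    (hDt : ∀ (l : List d) (i : d) (x : UnitAddTorus d), ∀ t ∈ Icc 0 T₀,
      HasDerivWithinAt (fun s => iterPartialDeriv l (fun y => D s y i) x)
        (iterPartialDeriv l (fun y => f t (y + proj (D t y)) i) x) (Icc 0 T₀) t)
    (hfb : ∀ n, 1 ≤ n → n ≤ N → ∀ t, dnorm n Rf (f t) ≤ Cf)
    {n : ℕ} (hn1 : 1 ≤ n) (hnN : n + 1 ≤ N) {t : ℝ} (ht : t ∈ Icc 0 T₀)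
    {l' : List d} (hl' : l'.length = n) (c i : d) (x : UnitAddTorus d) :
    |iterPartialDeriv (l' ++ [c]) (fun y => f t (y + proj (D t y)) i) x| ≤
      48 * (Fintype.card d : ℝ) ^ 2 * Cf * Rf *
        (((Nat.factorial n : ℝ) * (24 * (Fintype.card d : ℝ) * Rf * (1 + (Fintype.card d : ℝ) ^ 2)) ^ n) / ((n : ℝ) + 1) ^ 2) := by
  classical
  set dd : ℝ := (Fintype.card d : ℝ) with hdd
  have hdd1 : 1 ≤ dd := by
    have : Nonempty d := ⟨c⟩
    have hcard : 1 ≤ Fintype.card d := Nat.succ_le_of_lt Fintype.card_pos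
    rw [hdd]; exact_mod_cast hcard
  set R : ℝ := 24 * dd * Rf * (1 + dd ^ 2) with hR
  have hR0 : 0 < R := by positivity
  have hRge : 24 * (Fintype.card d : ℝ) * Rf ≤ R := by
    rw [hR, ← hdd]
    have : (1 : ℝ) ≤ 1 + dd ^ 2 := by nlinarith
    nlinarith [mul_pos (mul_pos (by norm_num : (0:ℝ) < 24) (by linarith : (0:ℝ) < dd)) hRf]
  -- the two factors and their product
  set H : d → UnitAddTorus d → ℝ := fun q y => partialDeriv q (fun z => f t z i) (y + proj (D t y)) with hH
  set G : d → UnitAddTorus d → ℝ := fun q y => (1 : Matrix d d ℝ) q c + partialDeriv c (fun x => D t x q) y with hG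
  have hHs : ∀ q, IsSmooth (H q) := fun q => isSmooth_comp_add_proj (((hfs t).apply i).partialDeriv q) (hDs t)
  have hGs : ∀ q, IsSmooth (G q) := fun q => (isSmooth_const _).add (((hDs t).apply q).partialDeriv c)
  have hHGs : ∀ q, IsSmooth (fun y => H q y * G q y) := fun q => (hHs q).mul (hGs q)
  have hprod : ∀ q, dnorm n R (fun y => H q y * G q y) ≤ 8 * (Cf * Rf) * (6 * dd) := fun q =>
    dnorm_mul_le (hHs q) (hGs q) hR0
      (fun j hj => by
        have h := dnorm_partialDeriv_comp_flow_le hCf hRf hfs hDs hD0 hT₀ hDt hfb hn1 hnN ht q i j hj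
        rw [← hdd] at h; exact h)
      (fun j hj => by
        have h := dnorm_flowJac_entry_le_all hCf hRf hfs hDs hD0 hT₀ hDt hfb hnN ht hRge q c j hj
        rw [← hdd] at h; exact h)
  -- the chain rule at order one, then linearity
  have e1 : iterPartialDeriv (l' ++ [c]) (fun y => f t (y + proj (D t y)) i) =
      iterPartialDeriv l' (fun y => ∑ q, H q y * G q y) := by
    rw [iterPartialDeriv_concat]
    congr 1
    funext y
    have h := iterPartialDeriv_singleton_comp_add_proj hfs hDs c i t y
    rw [iterPartialDeriv_cons, iterPartialDeriv_nil] at h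
    rw [h]
  have e2 : iterPartialDeriv l' (fun y => ∑ q, H q y * G q y) = fun y => ∑ q, iterPartialDeriv l' (fun y => H q y * G q y) y :=
    iterPartialDeriv_finset_sum _ (fun q _ => hHGs q) l'
  rw [e1, e2]
  calc |∑ q, iterPartialDeriv l' (fun y => H q y * G q y) x|
      ≤ ∑ q, |iterPartialDeriv l' (fun y => H q y * G q y) x| := Finset.abs_sum_le_sum_abs _ _
    _ ≤ ∑ _q : d, 8 * (Cf * Rf) * (6 * dd) * (((Nat.factorial n : ℝ) * R ^ n) / ((n : ℝ) + 1) ^ 2) :=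
        Finset.sum_le_sum fun q _ => by
          have h := norm_iterPartialDeriv_le_of_dnorm_le (hHGs q) hR0 (hprod q) hl' x
          rw [Real.norm_eq_abs] at h
          rw [← mul_div_assoc]
          exact h
    _ = dd * (8 * (Cf * Rf) * (6 * dd) * (((Nat.factorial n : ℝ) * R ^ n) / ((n : ℝ) + 1) ^ 2)) := by
        rw [Finset.sum_const, Finset.card_univ, nsmul_eq_mul, hdd]
    _ = 48 * dd ^ 2 * Cf * Rf * (((Nat.factorial n : ℝ) * R ^ n) / ((n : ℝ) + 1) ^ 2) := by ring

/-- **§4 MAIN: every label derivative of order `≥ 2` of the displacement is small, linearly in `C_f R_f t`.**  For the forward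
window flow `X = id + proj∘D` of `f` (smooth slices, `D(0) = 0`, the chain rule `∂ₜ∂^l D = ∂^l(f∘X)` WITHIN `[0,T₀]`,
`⟦f(t)⟧_{n,R_f} ≤ C_f` for `1 ≤ n ≤ N`, `T₀ ≤ 1/(4dC_fR_f)`): for `1 ≤ n`, `n + 1 ≤ N`, `t ∈ [0,T₀]`, every word `l` of length `n+1`,
`|∂^l D_i(t,x)| ≤ 48 d² C_f R_f t · n! R_*ⁿ/(n+1)²`, `R_* = 24dR_f(1+d²)` (§3 and the mean-value inequality from `∂^l D(0) = 0`).
[cite: ArmstrongVicol2025, App. A Prop. 7.10 (first display), Prop. 7.11; Hartman2002, Ch. V Thm 3.1] -/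
theorem abs_iterPartialDeriv_disp_le_forward_ofDerivWithin (hCf : 0 < Cf) (hRf : 0 < Rf)
    (hfs : ∀ t, IsSmooth (f t)) (hDs : ∀ t, IsSmooth (D t)) (hD0 : ∀ x, D 0 x = 0)
    {T₀ : ℝ} (hT₀ : T₀ ≤ 1 / (4 * (Fintype.card d : ℝ) * Cf * Rf))
    (hDt : ∀ (l : List d) (i : d) (x : UnitAddTorus d), ∀ t ∈ Icc 0 T₀,
      HasDerivWithinAt (fun s => iterPartialDeriv l (fun y => D s y i) x)
        (iterPartialDeriv l (fun y => f t (y + proj (D t y)) i) x) (Icc 0 T₀) t)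
    (hfb : ∀ n, 1 ≤ n → n ≤ N → ∀ t, dnorm n Rf (f t) ≤ Cf) :
    ∀ n, 1 ≤ n → n + 1 ≤ N → ∀ t ∈ Icc 0 T₀, ∀ (l : List d), l.length = n + 1 → ∀ (i : d) (x : UnitAddTorus d),
      |iterPartialDeriv l (fun y => D t y i) x| ≤
        48 * (Fintype.card d : ℝ) ^ 2 * Cf * Rf *
          (((Nat.factorial n : ℝ) * (24 * (Fintype.card d : ℝ) * Rf * (1 + (Fintype.card d : ℝ) ^ 2)) ^ n) / ((n : ℝ) + 1) ^ 2) * t := by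
  intro n hn1 hnN t ht l hl i x
  obtain ⟨l', c, rfl, hl'⟩ := List.exists_eq_concat_of_length_eq_succ hl
  set K : ℝ := 48 * (Fintype.card d : ℝ) ^ 2 * Cf * Rf *
    (((Nat.factorial n : ℝ) * (24 * (Fintype.card d : ℝ) * Rf * (1 + (Fintype.card d : ℝ) ^ 2)) ^ n) / ((n : ℝ) + 1) ^ 2) with hK
  -- the curve and its derivative within the window
  have hderiv : ∀ s ∈ Icc 0 T₀, HasDerivWithinAt (fun s => iterPartialDeriv (l' ++ [c]) (fun y => D s y i) x)
      (iterPartialDeriv (l' ++ [c]) (fun y => f s (y + proj (D s y)) i) x) (Icc 0 T₀) s := fun s hs => hDt (l' ++ [c]) i x s hs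
  have hbound : ∀ s ∈ Icc 0 T₀, ‖iterPartialDeriv (l' ++ [c]) (fun y => f s (y + proj (D s y)) i) x‖ ≤ K := fun s hs => by
    rw [Real.norm_eq_abs, hK]
    exact abs_iterPartialDeriv_comp_flow_le hCf hRf hfs hDs hD0 hT₀ hDt hfb hn1 hnN hs hl' c i x
  have h0 : (0 : ℝ) ∈ Icc 0 T₀ := ⟨le_rfl, ht.1.trans ht.2⟩
  have hMV := Convex.norm_image_sub_le_of_norm_hasDerivWithin_le hderiv hbound (convex_Icc 0 T₀) h0 ht
  have hz : iterPartialDeriv (l' ++ [c]) (fun y => D 0 y i) x = 0 :=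
    iterPartialDeriv_disp_zero hD0 (l := l' ++ [c]) (by simp) i x
  rw [hz, sub_zero, sub_zero, Real.norm_eq_abs, Real.norm_eq_abs, abs_of_nonneg ht.1] at hMV
  exact hMV

end General

end Summit.AnomalousDissipation.AnomalousDissipation.Theorems.SolenoidalFractalHomogenisation.LagrangianCarrierAnalytic

end
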